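import Summits.BirchSwinnertonDyer.BirchSwinnertonDyer.Theses.QuadraticBranchSignedControl
import HarnessLib

/-!
# Route `QuadraticBranchSignedControl` (rung K8, cell `bsd-potss`): the crux (R2±)
# `NoFiniteSubmoduleSigned` (item stmt-BirchSwinnertonDyer-19117) IS the conjunction of its two
# sign items `NoFiniteSubmodulePlus` (stmt-BirchSwinnertonDyer-19222) and `NoFiniteSubmoduleMinus`
# (stmt-BirchSwinnertonDyer-19233) — the registered composition `NoFiniteSubmoduleSigned_of` of the
# BC3 skeleton (stubs `stub_nfs_plus` / `stub_nfs_minus`), typed on the ROUTE DECLS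

HONEST FRAMING (cell `bsd-potss`, run/shared/lean/pub/bsd-potss/; FULL-BSD rank ≤ 1 programme,
tranche 1b): PURE LOGIC — nothing about Kitajima–Otsuki's theorem, Kobayashi's signed Selmer groups
or `BSD(W, p)` is proved or asserted here; no definition, no named Literature fact, no `sorry`, axioms
standard. After the tenure reshape (planner g10, 2026-08-26T01:29Z) the deciding theorem `closes`
takes the two sign items as binders `h₃a` / `h₃b` and derives the parent inline; this file records
the same equivalence as citable theorems so that the parent item closes the minute both children do
(`noFiniteSubmoduleSigned_of_signs`), and conversely (`noFiniteSubmodulePlus_of_signed`,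
`noFiniteSubmoduleMinus_of_signed`). It does NOT close any item.

References: [KitajimaOtsuki2018] Main Thm. 1.3 (= Thm. 4.8) (the statement both sign items read);
[Kobayashi2003] Def. 2.1 (p. 5), §4 p. 8 (the objects).
-/

set_option autoImplicit false
set_option linter.dupNamespace false

namespace Summit.BirchSwinnertonDyer.BirchSwinnertonDyer.Theorems

open Summit.BirchSwinnertonDyer.BirchSwinnertonDyer.Theses.QuadraticBranchSignedControl

/-- **(R2±) from (R2⁺) and (R2⁻)** — the registered composition `NoFiniteSubmoduleSigned_of` of the
BC3 skeleton of item stmt-BirchSwinnertonDyer-19117, typed on the route decls of its two sign items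
(stmt-BirchSwinnertonDyer-19222 / 19233): for every `W`, `p ≥ 5`, the pair of the plus and the
strict-minus no-finite-submodule statements. Pure logic.
[cite: KitajimaOtsuki2018, Main Thm. 1.3 (= Thm. 4.8) (statement only; nothing asserted)] -/
theorem noFiniteSubmoduleSigned_of_signs (hplus : NoFiniteSubmodulePlus)
    (hminus : NoFiniteSubmoduleMinus) : NoFiniteSubmoduleSigned :=
  fun W _ _ p _ hp5 => ⟨hplus W p hp5, hminus W p hp5⟩

/-- The plus sign item is the first projection of the parent crux. Pure logic.
[cite: KitajimaOtsuki2018, Main Thm. 1.3 (statement only; nothing asserted)] -/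
theorem noFiniteSubmodulePlus_of_signed (h : NoFiniteSubmoduleSigned) : NoFiniteSubmodulePlus :=
  fun W _ _ p _ hp5 => (h W p hp5).1

/-- The minus sign item is the second projection of the parent crux. Pure logic.
[cite: KitajimaOtsuki2018, Main Thm. 1.3 (statement only; nothing asserted)] -/
theorem noFiniteSubmoduleMinus_of_signed (h : NoFiniteSubmoduleSigned) : NoFiniteSubmoduleMinus :=
  fun W _ _ p _ hp5 => (h W p hp5).2

end Summit.BirchSwinnertonDyer.BirchSwinnertonDyer.Theorems
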